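import Mathlib
import Summits.Ventures.PercRepro2.Defs
import Summits.Ventures.PercRepro2.Independence
import Summits.Ventures.PercRepro2.Graph
import Summits.Ventures.PercRepro2.Exploration
import Summits.Ventures.PercRepro2.Induced
import Summits.Ventures.PercRepro2.R2PrimeThreeReduction
import Summits.Ventures.PercRepro2.YBridge
import Summits.Ventures.PercRepro2.HCov
import Summits.Ventures.PercRepro2.HubModel
import Summits.Ventures.PercRepro2.HubLaw
import Summits.Ventures.PercRepro2.HubRootLaw
import Summits.Ventures.PercRepro2.HubConn
import Summits.Ventures.PercRepro2.HubBernstein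
import Summits.Ventures.PercRepro2.HubGc
import Summits.Ventures.PercRepro2.HubKron
import Summits.Ventures.PercRepro2.HubCert
import Summits.Ventures.PercRepro2.HubCertPart1
import Summits.Ventures.PercRepro2.HubCertPart2
import Summits.Ventures.PercRepro2.HubCertPart3
import Summits.Ventures.PercRepro2.HubCertPart4
import Summits.Ventures.PercRepro2.HubCertPart5
import Summits.Ventures.PercRepro2.HubCertPart6

/-!
# All hub certificates, and their Kronecker numbers
(blind cell PercRepro2, typer-1 g8; HUB-LEAN-SCOPE.md (S4), kernel route)

`certList` gathers the 330 certificates; `certNum a b d` is the Kronecker number of their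
symmetrised tensors at the atom triple `(a, b, d)`, `kronSym a b d` the symmetrised Kronecker hub
number (six `kronW`).  The three kernel facts about the data: every key is a valid index
(`cert_keys`), every multiplier is nonnegative (`cert_nonneg`), and the certificate digits are
balanced (`cert_bound`).  The identity `2 · kronSym = certNum` is checked in `HubKernelChunk0.lean` …
`HubKernelChunk3.lean` and `HubTheorem.lean` (one first index per file) and assembled in `HubTheorem.lean`.
-/

namespace Summit.Ventures.PercRepro2.Hub

/-- All certificates (330 type vectors). -/
def certList : List (ℕ × Cert) :=
  certList1 ++ certList2 ++ certList3 ++ certList4 ++ certList5 ++ certList6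

/-- The symmetrised Kronecker hub number of an atom triple. -/
def kronSym (a b d : Fin 5) : ℤ :=
  kronW (atomPat a) (atomPat b) (atomPat d) + kronW (atomPat a) (atomPat d) (atomPat b) +
    kronW (atomPat b) (atomPat a) (atomPat d) + kronW (atomPat b) (atomPat d) (atomPat a) +
    kronW (atomPat d) (atomPat a) (atomPat b) + kronW (atomPat d) (atomPat b) (atomPat a)

/-- The Kronecker number of the symmetrised certificates of an atom triple. -/
def certNum (a b d : Fin 5) : ℤ := (certList.map fun e => sym3 (rhs e.2) a b d * KB ^ e.1).sum

set_option maxHeartbeats 0 in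
/-- The certificate digits are balanced: their absolute values sum to less than `2^31`. -/
theorem cert_bound : ∀ a b d : Fin 5,
    (certList.map fun e => |sym3 (rhs e.2) a b d|).sum < 2 ^ 31 := by
  decide +kernel

set_option maxHeartbeats 0 in
/-- Every certificate key is a valid index. -/
theorem cert_keys : certList.all (fun e => decide (e.1 < 16384)) = true := by
  decide +kernel

set_option maxHeartbeats 0 in
/-- Every certificate has nonnegative multipliers. -/
theorem cert_nonneg : certList.all (fun e => certNonneg e.2) = true := by
  decide +kernel

end Summit.Ventures.PercRepro2.Hub
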